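import Mathlib

/-!
# The first-order GMA identities behind §7.11 (16.4)–(16.5) (solo-informed)

In §7.11 (16.4)–(16.5) a first-order Eisenstein deformation along a Kummer direction `η` is realised
by a generalised matrix algebra representation over the dual numbers,
`ρ(g) = (1 + ε a(g), ε c(g); κ(g) + ε b(g), ω(g)(1 + ε d(g)))`,
and multiplicativity `ρ(gh) = ρ(g)ρ(h)` unfolds into cochain identities, among them
* (1,1): `a(gh) = a(g) + a(h) + c(g) κ(h)`,
* (1,2): `c(gh) = c(h) + ω(h) c(g)`,   (2,1) at order zero: `κ(gh) = κ(g) + ω(g) κ(h)`,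
* (2,2): `d(gh) = d(g) + d(h) + ω(gh)⁻¹ κ(g) c(h)`.

Three purely algebraic consequences are used in the text and are recorded here for an arbitrary
group `G` and commutative coefficient ring:

1. `soloInformed_gma_additive_on_ker`: on any subgroup on which `κ` vanishes, `a` is additive
   ((16.5)(a): `a` restricted to `G_{F(η^{1/p})}` is a homomorphism).
2. `soloInformed_gma_offDiag_vanishes_on_normal`: if `a` and `κ` vanish on a NORMAL subgroup `N` and
   `κ(g) ≠ 0` for some `g`, then `c` vanishes on `N`.  This is the group-theoretic core of the
   NON-VANISHING of the class-group character `ψ_η` in (16.5)(a): were `a` zero on `G_{F(η^{1/p})}`, it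
   would be zero on the normal subgroup `G_L`, `L = F(ζ_p, η^{1/p})`, forcing `c₀|_{G_L} = 0`, which
   Kummer theory excludes for `p ≥ 5`.  The argument uses only the (1,1) identity — no injectivity of
   restriction maps.
3. `soloInformed_gma_det_additive`: `ψ := a + d − ω⁻¹ κ c` is additive ((16.4): the first-order
   coefficient of `det ρ` is a homomorphism), from the (1,1), (1,2), (2,1), (2,2) identities.
-/

namespace Summit.Langlands.Langlands.Theorems

/-- (16.5)(a), homomorphism part: where `κ` vanishes, the (1,1)-cochain `a` is additive. -/
theorem soloInformed_gma_additive_on_ker {G : Type*} [Group G] {k : Type*} [CommRing k]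
    (a c κ : G → k) (H : Subgroup G)
    (hGMA : ∀ g h : G, a (g * h) = a g + a h + c g * κ h) (hκH : ∀ h ∈ H, κ h = 0)
    {g h : G} (_hg : g ∈ H) (hh : h ∈ H) : a (g * h) = a g + a h := by
  rw [hGMA, hκH h hh, mul_zero, add_zero]

/-- (16.5)(a), non-vanishing part (group-theoretic core): if `a(gh) = a(g) + a(h) + c(g) κ(h)` for all
`g, h`, if `a` and `κ` vanish on a normal subgroup `N`, and if `κ(g) ≠ 0` for some `g`, then the
cocycle `c` vanishes on `N`.  Proof: for `m ∈ N` put `n := g⁻¹ m g ∈ N`; then `g n = m g`, and the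
identity evaluated on `g·n` and on `m·g` gives `a(g) = a(g) + c(m) κ(g)`. -/
theorem soloInformed_gma_offDiag_vanishes_on_normal {G : Type*} [Group G] {k : Type*} [CommRing k]
    [NoZeroDivisors k] (a c κ : G → k) (N : Subgroup G) [hN : N.Normal]
    (hGMA : ∀ g h : G, a (g * h) = a g + a h + c g * κ h)
    (hκN : ∀ n ∈ N, κ n = 0) (haN : ∀ n ∈ N, a n = 0) {g : G} (hg : κ g ≠ 0) :
    ∀ m ∈ N, c m = 0 := by
  intro m hm
  have hn : g⁻¹ * m * g ∈ N := hN.conj_mem' m hm g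
  have h1 : a (g * (g⁻¹ * m * g)) = a g := by
    rw [hGMA, haN _ hn, hκN _ hn, mul_zero, add_zero, add_zero]
  have h2 : a (m * g) = a g + c m * κ g := by
    rw [hGMA, haN m hm, zero_add]
  have h3 : g * (g⁻¹ * m * g) = m * g := by group
  rw [h3, h2] at h1
  have h4 : c m * κ g = 0 := by linear_combination h1
  exact (mul_eq_zero.1 h4).resolve_right hg

/-- (16.4): the first-order coefficient `ψ = a + d − ω⁻¹ κ c` of the determinant is additive.  Here
`ω, ωi : G → k` with `ω(g) ωi(g) = 1` and `ωi` multiplicative play the roles of `ω` and `ω⁻¹`. -/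
theorem soloInformed_gma_det_additive {G : Type*} [Group G] {k : Type*} [CommRing k]
    (a c d κ ω ωi : G → k)
    (hinv : ∀ g : G, ω g * ωi g = 1) (hωi : ∀ g h : G, ωi (g * h) = ωi g * ωi h)
    (ha : ∀ g h : G, a (g * h) = a g + a h + c g * κ h)
    (hc : ∀ g h : G, c (g * h) = c h + ω h * c g)
    (hκ : ∀ g h : G, κ (g * h) = κ g + ω g * κ h)
    (hd : ∀ g h : G, d (g * h) = d g + d h + ωi g * ωi h * κ g * c h) (g h : G) :
    a (g * h) + d (g * h) - ωi (g * h) * κ (g * h) * c (g * h)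
      = (a g + d g - ωi g * κ g * c g) + (a h + d h - ωi h * κ h * c h) := by
  rw [ha, hd, hc, hκ, hωi]
  linear_combination (-(ωi g * κ g * c g) - c g * κ h * (ω g * ωi g)) * hinv h
    + (-(ωi h * κ h * c h) - c g * κ h) * hinv g

end Summit.Langlands.Langlands.Theorems
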